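import Literature.Combinatorics.SimpleGraph.FKVertexForm
import Literature.Combinatorics.SimpleGraph.KYAdjToSeidel
import HarnessLib

/-!
# Kunisky–Yu §3.1/§3.4: the cross block `H^{1,2}` applied to a pair vector, through `S`

Continuation of `FKVertexForm.lean` and `KYAdjToSeidel.lean` (Kunisky–Yu 2022, arXiv:2211.02713).
For the vertex form `uᵀH^{1,1}u + Σ_a u_a w_a + F` we compute the cross vector
`w_a = Σ_{c,d} Vm_{cd} H({a},{c,d})` (KY (36): `H^{1,2}_{a,{b,c}} = α₂ − α₁α₂` if `a ∈ {b,c}`, else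
`α₃ 1_{1,2} − α₁α₂`) for a symmetric zero-diagonal `Vm`, in terms of the Seidel matrix `S`:

* `kyEntry_singleton_pair` — KY (36) in one formula: for `c ≠ d`,
  `H({a},{c,d}) = α₃ A_{ac}A_{ad} − α₁α₂ + α₂([a=c] + [a=d])`.
* `crossVector_eq` — with `g = Vm𝟙`, `σ₀ = 𝟙ᵀVm𝟙`, `h_a = Σ_c S_{ac}Vm_{ca}`, `ℓ_a = (SVmS)_{aa}`:
  `w_a = (2α₂ − α₃/2) g_a + (α₃/4 − α₁α₂) σ₀ + (α₃/2)(Sg)_a + (α₃/4) ℓ_a − (α₃/2) h_a`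
  (the graph-matrix expansion (53) of `H^{2,1}H^{1,2}`, taken before squaring).
* `sum_crossVector_eq` — `Σ_a w_a = (2α₂ − ¾α₃ + (α₃/4 − α₁α₂)q) σ₀ − (α₃/2) Σ_{a,c} S_{ac}Vm_{ca}`
  for `S𝟙 = 0`, `S² = qI − J`.

## References

* [KuniskyYu2022] D. Kunisky, X. Yu, arXiv:2211.02713, (36), (53), (55).
-/

noncomputable section

namespace Literature.Combinatorics.SimpleGraph

open Matrix Finset

section CrossVector

variable {V : Type*} [Fintype V] [DecidableEq V] (G : _root_.SimpleGraph V) [DecidableRel G.Adj]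

omit [Fintype V] in
/-- **KY (36) in one formula**: for `c ≠ d`,
`H({a},{c,d}) = α₃ A_{ac}A_{ad} − α₁α₂ + α₂([a = c] + [a = d])` (if `a ∈ {c,d}` the product
`A_{ac}A_{ad}` vanishes and the value is `α₂ − α₁α₂`; otherwise
`1_{1,2}({a},{c,d}) = A_{ac}A_{ad}`).
[cite: KuniskyYu2022, (36)] -/
theorem kyEntry_singleton_pair (α : ℕ → ℝ) (a : V) {c d : V} (hcd : c ≠ d) :
    kyEntry G α {a} {c, d} = α 3 * (G.adjMatrix ℝ a c * G.adjMatrix ℝ a d) - α 1 * α 2 +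
      α 2 * ((if a = c then 1 else 0) + (if a = d then 1 else 0)) := by
  have hA0 : ∀ x, G.adjMatrix ℝ x x = 0 := fun x => by simp [SimpleGraph.adjMatrix_apply]
  rw [kyEntry, bipInd_apply, card_singleton, card_pair hcd]
  by_cases hac : a = c
  · subst hac
    have hu : ({a} : Finset V) ∪ {a, d} = {a, d} := by
      ext v; simp only [mem_union, mem_singleton, mem_insert]; tauto
    have hbip : ∀ v ∈ ({a} : Finset V) \ {a, d}, ∀ w ∈ ({a, d} : Finset V) \ {a}, G.Adj v w := by
      intro v hv
      simp only [mem_sdiff, mem_singleton, mem_insert] at hv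
      exact (hv.2 (Or.inl hv.1)).elim
    rw [hu, card_pair hcd, if_pos hbip, if_pos rfl, if_neg hcd, hA0]
    ring
  by_cases had : a = d
  · subst had
    have hu : ({a} : Finset V) ∪ {c, a} = {c, a} := by
      ext v; simp only [mem_union, mem_singleton, mem_insert]; tauto
    have hbip : ∀ v ∈ ({a} : Finset V) \ {c, a}, ∀ w ∈ ({c, a} : Finset V) \ {a}, G.Adj v w := by
      intro v hv
      simp only [mem_sdiff, mem_singleton, mem_insert] at hv
      exact (hv.2 (Or.inr hv.1)).elim
    rw [hu, card_pair hcd, if_pos hbip, if_neg hac, if_pos rfl, hA0]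
    ring
  · have hu : ({a} : Finset V) ∪ {c, d} = {a, c, d} := by
      ext v; simp only [mem_union, mem_singleton, mem_insert]
    have hc3 : ({a, c, d} : Finset V).card = 3 := card_eq_three.2 ⟨a, c, d, hac, had, hcd, rfl⟩
    have hs1 : ({a} : Finset V) \ {c, d} = {a} := by
      ext v; simp only [mem_sdiff, mem_singleton, mem_insert]
      constructor
      · exact fun h => h.1
      · intro h; subst h; exact ⟨rfl, fun h => h.elim hac had⟩
    have hs2 : ({c, d} : Finset V) \ {a} = {c, d} := by
      ext v; simp only [mem_sdiff, mem_singleton, mem_insert]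
      constructor
      · exact fun h => h.1
      · intro h; refine ⟨h, ?_⟩; rcases h with rfl | rfl
        · exact fun h => hac h.symm
        · exact fun h => had h.symm
    rw [hu, hc3, hs1, hs2, if_neg hac, if_neg had]
    simp only [mem_singleton, mem_insert, forall_eq_or_imp, forall_eq, SimpleGraph.adjMatrix_apply]
    by_cases h1 : G.Adj a c <;> by_cases h2 : G.Adj a d <;> simp [h1, h2]

/-- **The cross vector through `S`** (KY (36) with (53) before squaring): for `Vm` symmetric with
zero
diagonal and `S` the Seidel matrix,
`Σ_{c,d} Vm_{cd} H({a},{c,d}) = (2α₂ − α₃/2) g_a + (α₃/4 − α₁α₂) σ₀ + (α₃/2) Σ_c S_{ac} g_c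
  + (α₃/4) Σ_{c,d} S_{ac}Vm_{cd}S_{da} − (α₃/2) Σ_c S_{ac}Vm_{ca}`
with `g_c = Σ_d Vm_{cd}`, `σ₀ = Σ_{c,d} Vm_{cd}`. [cite: KuniskyYu2022, (36) and (53)] -/
theorem crossVector_eq {S : Matrix V V ℝ}
    (hS : ∀ a b, S a b = if a = b then 0 else if G.Adj a b then 1 else -1)
    (α : ℕ → ℝ) (Vm : Matrix V V ℝ) (hVs : ∀ x y, Vm x y = Vm y x) (hVd : ∀ x, Vm x x = 0) (a : V) :
    ∑ c, ∑ d, Vm c d * kyEntry G α {a} {c, d} =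
      (2 * α 2 - α 3 / 2) * ∑ d, Vm a d + (α 3 / 4 - α 1 * α 2) * ∑ c, ∑ d, Vm c d +
        α 3 / 2 * ∑ c, S a c * ∑ d, Vm c d +
        α 3 / 4 * ∑ c, ∑ d, S a c * Vm c d * S d a - α 3 / 2 * ∑ c, S a c * Vm c a := by
  have hSs : ∀ x y, S x y = S y x := by
    intro x y; rw [hS, hS]
    by_cases h : x = y
    · subst h; rfl
    · rw [if_neg h, if_neg (Ne.symm h)]
      by_cases hadj : G.Adj x y
      · rw [if_pos hadj, if_pos hadj.symm]
      · rw [if_neg hadj, if_neg (fun h' => hadj h'.symm)]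
  -- pointwise, through `S`
  have e : ∀ c d, Vm c d * kyEntry G α {a} {c, d} =
      (α 3 / 4 - α 1 * α 2) * Vm c d + α 3 / 4 * (S a c * Vm c d) + α 3 / 4 * (Vm c d * S d a) +
        α 3 / 4 * (S a c * Vm c d * S d a) +
        (if a = c then (α 2 - α 3 / 4) * Vm c d - α 3 / 4 * (Vm c d * S d a) else 0) +
        (if a = d then (α 2 - α 3 / 4) * Vm c d - α 3 / 4 * (S a c * Vm c d) else 0) := by
    intro c d
    by_cases hcd : c = d
    · subst hcd; rw [hVd]; simp
    rw [kyEntry_singleton_pair G α a hcd, adjMatrix_eq_seidel G hS, adjMatrix_eq_seidel G hS]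
    by_cases hac : a = c
    · have had : ¬ a = d := fun h => hcd (hac.symm.trans h)
      have hSac : S a c = 0 := by rw [hac, hS, if_pos rfl]
      simp only [if_pos hac, if_neg had, hSac]
      ring
    by_cases had : a = d
    · have hSad : S a d = 0 := by rw [had, hS, if_pos rfl]
      have hSda : S d a = 0 := by rw [hSs d a, hSad]
      simp only [if_neg hac, if_pos had, hSad, hSda]
      ring
    · simp only [if_neg hac, if_neg had]
      rw [hSs d a]
      ring
  simp only [e, Finset.sum_add_distrib]
  have s1 : ∑ c, ∑ d, (α 3 / 4 - α 1 * α 2) * Vm c d =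
      (α 3 / 4 - α 1 * α 2) * ∑ c, ∑ d, Vm c d := by
    simp only [Finset.mul_sum]
  have s2 : ∑ c, ∑ d, α 3 / 4 * (S a c * Vm c d) = α 3 / 4 * ∑ c, S a c * ∑ d, Vm c d := by
    rw [Finset.mul_sum]
    refine Finset.sum_congr rfl fun c _ => ?_
    rw [Finset.mul_sum, Finset.mul_sum]
  have s3 : ∑ c, ∑ d, α 3 / 4 * (Vm c d * S d a) = α 3 / 4 * ∑ c, S a c * ∑ d, Vm c d := by
    rw [Finset.sum_comm, Finset.mul_sum]
    refine Finset.sum_congr rfl fun d _ => ?_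
    rw [Finset.mul_sum, Finset.mul_sum]
    exact Finset.sum_congr rfl fun c _ => by rw [hSs d a, hVs c d]; ring
  have s4 : ∑ c, ∑ d, α 3 / 4 * (S a c * Vm c d * S d a) =
      α 3 / 4 * ∑ c, ∑ d, S a c * Vm c d * S d a := by
    simp only [Finset.mul_sum]
  have s5 : ∑ c, ∑ d, (if a = c then (α 2 - α 3 / 4) * Vm c d - α 3 / 4 * (Vm c d * S d a) else 0) =
      (α 2 - α 3 / 4) * ∑ d, Vm a d - α 3 / 4 * ∑ c, S a c * Vm c a := by
    rw [Finset.sum_comm]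
    simp only [Finset.sum_ite_eq, mem_univ, if_true, Finset.sum_sub_distrib, ← Finset.mul_sum]
    congr 1
    congr 1
    exact Finset.sum_congr rfl fun d _ => by rw [hSs d a, hVs a d, mul_comm]
  have s6 : ∑ c, ∑ d, (if a = d then (α 2 - α 3 / 4) * Vm c d - α 3 / 4 * (S a c * Vm c d) else 0) =
      (α 2 - α 3 / 4) * ∑ d, Vm a d - α 3 / 4 * ∑ c, S a c * Vm c a := by
    simp only [Finset.sum_ite_eq, mem_univ, if_true, Finset.sum_sub_distrib, ← Finset.mul_sum]
    congr 1
    congr 1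
    exact Finset.sum_congr rfl fun c _ => hVs c a
  rw [s1, s2, s3, s4, s5, s6]
  ring

/-- **`Σ_a w_a`** for a conference Seidel matrix (`S𝟙 = 0`, `S² = qI − J`; KY (55), the `P₀`-part):
`Σ_a Σ_{c,d} Vm_{cd}H({a},{c,d}) = (2α₂ − ¾α₃ + (α₃/4 − α₁α₂)q) σ₀ − (α₃/2) Σ_{a,c} S_{ac}Vm_{ca}`.
[cite: KuniskyYu2022, (55)] -/
theorem sum_crossVector_eq {S : Matrix V V ℝ}
    (hS : ∀ a b, S a b = if a = b then 0 else if G.Adj a b then 1 else -1)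
    (hrow : ∀ a, ∑ b, S a b = 0)
    (hsq : S * S = (Fintype.card V : ℝ) • (1 : Matrix V V ℝ) - of fun _ _ => 1)
    (α : ℕ → ℝ) (Vm : Matrix V V ℝ) (hVs : ∀ x y, Vm x y = Vm y x) (hVd : ∀ x, Vm x x = 0) :
    ∑ a, ∑ c, ∑ d, Vm c d * kyEntry G α {a} {c, d} =
      (2 * α 2 - 3 / 4 * α 3 + (α 3 / 4 - α 1 * α 2) * Fintype.card V) * ∑ c, ∑ d, Vm c d -
        α 3 / 2 * ∑ a, ∑ c, S a c * Vm c a := by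
  have hSs : ∀ x y, S x y = S y x := by
    intro x y; rw [hS, hS]
    by_cases h : x = y
    · subst h; rfl
    · rw [if_neg h, if_neg (Ne.symm h)]
      by_cases hadj : G.Adj x y
      · rw [if_pos hadj, if_pos hadj.symm]
      · rw [if_neg hadj, if_neg (fun h' => hadj h'.symm)]
  have hcol : ∀ c, ∑ a, S a c = 0 := fun c => by
    rw [show ∑ a, S a c = ∑ a, S c a from Finset.sum_congr rfl fun a _ => hSs a c]; exact hrow c
  simp only [crossVector_eq G hS α Vm hVs hVd, Finset.sum_add_distrib, Finset.sum_sub_distrib,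
    ← Finset.mul_sum]
  -- `Σ_a (Sg)_a = 0`
  have h1 : ∑ a, ∑ c, S a c * ∑ d, Vm c d = 0 := by
    rw [Finset.sum_comm]
    exact Finset.sum_eq_zero fun c _ => by rw [← Finset.sum_mul, hcol c, zero_mul]
  -- `Σ_a ℓ_a = Σ_{c,d} Vm_cd (S²)_{dc} = -σ₀`
  have h2 : ∑ a, ∑ c, ∑ d, S a c * Vm c d * S d a = -∑ c, ∑ d, Vm c d := by
    have e1 : ∑ a, ∑ c, ∑ d, S a c * Vm c d * S d a = ∑ c, ∑ d, Vm c d * (S * S) d c := by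
      rw [Finset.sum_comm]
      refine Finset.sum_congr rfl fun c _ => ?_
      rw [Finset.sum_comm]
      refine Finset.sum_congr rfl fun d _ => ?_
      rw [mul_apply, Finset.mul_sum]
      exact Finset.sum_congr rfl fun a _ => by ring
    rw [e1, hsq]
    have e2 : ∀ c d, Vm c d *
        ((((Fintype.card V : ℝ) • (1 : Matrix V V ℝ) - of fun _ _ => (1 : ℝ)) : Matrix V V ℝ) d c) =
        (if c = d then (Fintype.card V : ℝ) * Vm c d else 0) - Vm c d := by
      intro c d
      simp only [Matrix.sub_apply, Matrix.smul_apply, one_apply, of_apply, smul_eq_mul]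
      by_cases h : c = d
      · subst h; rw [if_pos rfl, if_pos rfl]; ring
      · rw [if_neg (Ne.symm h), if_neg h]; ring
    simp only [e2, Finset.sum_sub_distrib, Finset.sum_ite_eq, mem_univ, if_true, hVd, mul_zero,
      zero_sub, Finset.sum_neg_distrib]
  -- `Σ_a g_a = σ₀`
  rw [h1, h2, sum_const, card_univ, nsmul_eq_mul]
  ring

end CrossVector

end Literature.Combinatorics.SimpleGraph

end
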